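import Summits.QuantumFields.BalabanUV.T4Continuum.Support.NE9KernelSpeciesCoupling
import Summits.QuantumFields.BalabanUV.T4Continuum.Support.NE9Lemma1KernelSpeciesAdditive
import Summits.QuantumFields.BalabanUV.T4Continuum.Support.NE9KernelGeometry
import Summits.QuantumFields.BalabanUV.T4Continuum.Support.NE9LatticeExpSums
import Summits.QuantumFields.BalabanUV.T4Continuum.Support.NE9RemainderSpeciesWitness

/-!
# NE9KernelSpeciesWitness — NON-VACUITY of species (b)'s displayed binder set: a toy `KerData` with a BILOCAL,
# COUPLING-DEPENDENT summand over the 3⁴-point box of ℤ⁴ inhabiting `KerData.Admissible` — (G) discharged BY NAME from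
# `NE9KernelGeometry.geom_family`, (S) BY NAME from `NE9LatticeExpSums` — together with (A), (C), (K-Lip); whence the four
# S-binders ((w23) `sBinders_ker`) and leaf A3's `hTcup` (A3-KER `channelCouplingModulus_ker`) FIRE on it
# (cell `pub-balaban`, T4-DAG §2 node U3 / §6 NE9; swarm unit b2b-balaban-t4-ne9-formalise-leaf-09, generation 6; own-initiative
# micro-item «KER-WITNESS», journal CLAIM l.10905 — the species-(b) twin of this lineage's REM-WITNESS p213736)

HONEST FRAMING (T4-DAG PAGE 1).  Rung (B)+1 of the FINITE-VOLUME T⁴ programme — NOT infinite volume, NOT a mass gap, NOT the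
Clay problem.  NE9 (`T4OutputRate.NE9` ∧ `FadingMemory`) is a cell NEW ESTIMATE, NOT PRINTED, NOT discharged here; spine 0/9;
0/18 skeleton leaves instantiated on Bałaban's objects (O-NE9-1).  HONEST DEPENDENCY (cell line, verbatim): continuum YM on T⁴
⇐ BetaPertH ∧ nine spine estimates (0/9 proved); BetaPertH ⇐ (D1) ∧ (D4) ∧ CAP+tail; G-an2-4 gates asym, D1 and NE2/3/4.
`FlowStep.BetaPertH`, (B), (B^μ) do not occur.  [I] = [Balaban1987RG1] (CMP **109**) is quoted for TYPES only (ABSOLUTE RULE).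

WHAT THIS FILE IS — A TOY, LABELLED AS SUCH.  The kernel species of the row owner (`NE9Lemma1KernelSpecies.KerData`, p214555: the
point-localized terms of [I] §4) reaches the NE9 END through DISPLAYED binders only: `KerData.Admissible` ((K) the p. 286
summand bound, (G) ξ-geometry, (S) lattice sums, source discipline, G1), the summand regularity (A)/(C) of (w23)
(`NE9Lemma1KernelSpeciesAdditive`, p214868) and the coupling-Lipschitz TYPE (K-Lip) of A3-KER (`NE9KernelSpeciesCoupling`,
p214870), plus the level counts at the output rate.  This file shows the set is JOINTLY SATISFIABLE by non-degenerate data and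
that the producers compose: on the doubled toy carriers (index frame of `NE9RemainderSpeciesWitness.wRem`, so the level counts
transfer definitionally) the datum `wKer γ` takes the unit-lattice points of the box `[−1,1]⁴ ⊂ ℤ⁴` (81 points, sup metric),
base point 0, `dX X p := infDist p {0}`, `ρd := dist`, power `m = 1`, and the summand
`ker k s … p q F := F(0) · clamp_γ(s_k) · |p − q| · e^{−(dX p + dX q)}` — bilocal, coupling-dependent through the k-th coupling,
linear in the old term.  PROVED: `admissible_wKer` (all fields; **(G) := `geom_family`** of p214491 at `S X := {0}`, Δ = 0,
δ₁ = ½, δ₀ = 1, w = w₀ = 0; **(S) := `sum_exp_neg_dist_le` / `sum_pow_mul_exp_neg_dist_le`** of p214386 at d = 4, δ = ½ — the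
instantiation recipes of the two lattice-model reductions, kernel-checked on a datum), `kerA_wKer` (A), `kerC_wKer` (C),
`kerL_wKer` ((K-Lip), cK = λ = 1), `levelCountsG_wKer`; and the FIRINGS **`sBinders_witness_ker`** (S3/S4/S5 for the toy's
channel on its analytic class — (w23) applied) and **`tcup_witness_ker`** (leaf A3's `hTcup` at the toy window family `wE γ` —
A3-KER applied; `qT = 1·γ·1·(1−ω)⁻¹`).  NOTHING of Bałaban's is instantiated (O-NE9-1); the toy says only that the binder
shapes are not contradictory and not vacuous, and that the modules' sockets fit BY NAME.
DISGUISE TEST: toy data; no NE9 content.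

References (TYPES only): [Balaban1987RG1] T. Bałaban, CMP **109** (1987) 249–301, (4.21)–(4.22) pp. 285–286.  Summits-side NEW
work (LEAN PLACEMENT RULE); imports p214870, p214868, p214491, p214386, p213736 BY NAME; modifies nothing; 0 sorry; toy `def`s
`ptsBox`, `wKer` only (no `def … : Prop`).  Value = non-vacuity bookkeeping, NOT summit progress.
-/

noncomputable section

namespace Summit.QuantumFields.BalabanUV.T4Continuum.NE9KernelSpeciesWitness

open scoped BigOperators
open Metric Set Complex
open Literature.MathematicalPhysics.QuantumFieldTheory.Balaban1983to89
open Literature.MathematicalPhysics.QuantumFieldTheory.Balaban1983to89.T4OutputRate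
open Literature.MathematicalPhysics.QuantumFieldTheory.Balaban1983to89.T4HistoryLipschitzRecursion
open Literature.MathematicalPhysics.QuantumFieldTheory.Balaban1983to89.T4HistoryLipschitzSegment
open Summit.QuantumFields.BalabanUV.T4Continuum.NE9Lemma1Counting
open Summit.QuantumFields.BalabanUV.T4Continuum.NE9Lemma1Gain
open Summit.QuantumFields.BalabanUV.T4Continuum.NE9Lemma1PieceClass
open Summit.QuantumFields.BalabanUV.T4Continuum.NE9Lemma1RemainderSpecies
open Summit.QuantumFields.BalabanUV.T4Continuum.NE9Lemma1KernelSpecies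
open Summit.QuantumFields.BalabanUV.T4Continuum.NE9Lemma1KernelSpeciesAdditive (sBinders_ker)
open Summit.QuantumFields.BalabanUV.T4Continuum.NE9KernelSpeciesCoupling (channelCouplingModulus_ker)
open Summit.QuantumFields.BalabanUV.T4Continuum.NE9KernelGeometry (geom_family)
open Summit.QuantumFields.BalabanUV.T4Continuum.NE9LatticeExpSums (sum_exp_neg_dist_le sum_pow_mul_exp_neg_dist_le)
open Summit.QuantumFields.BalabanUV.T4Continuum.NE9RemainderSpeciesWitness
  (gClamp abs_gClamp_le abs_gClamp_sub_le srcPair fst_eq_of_mem_srcPair wRem wE levelCountsG_wRem wE_mem_analyticClass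
    termSize_wE)
open Summit.QuantumFields.BalabanUV.T4Continuum.NE9ComplexEncoding (doubleCarriers)

/-! ## §1 The toy datum -/

/-- The unit-lattice points of the box `[−1, 1]⁴ ⊂ ℤ⁴` (81 points; ↔ x, x₃ ∈ □̃⁴ ∩ T₁^{(j)} of [I] p. 285, toy size).
[folklore] -/
def ptsBox : Finset (Fin 4 → ℤ) := Fintype.piFinset fun _ => Finset.Icc (-1) 1

/-- The two (S)-constants of `NE9LatticeExpSums` at `d = 4`, `δ = ½`, `m = 1`, written out (so that the `Admissible` statement is
closed): `c₀ = (2/(1 − e^{−1/8}))⁴`, `c₁ = (2/(e·½))·(2/(1 − e^{−1/16}))⁴`. -/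
theorem c0_c1_nonneg :
    0 ≤ (2 / (1 - Real.exp (-((1 / 2 : ℝ) / ((4 : ℕ) : ℝ))))) ^ (4 : ℕ) ∧
      0 ≤ (2 * ((1 : ℕ) : ℝ) / (Real.exp 1 * (1 / 2 : ℝ))) ^ (1 : ℕ) *
        (2 / (1 - Real.exp (-((1 / 2 : ℝ) / 2 / ((4 : ℕ) : ℝ))))) ^ (4 : ℕ) := by
  have h1 : Real.exp (-((1 / 2 : ℝ) / ((4 : ℕ) : ℝ))) < 1 := Real.exp_lt_one_iff.2 (by norm_num)
  have h2 : Real.exp (-((1 / 2 : ℝ) / 2 / ((4 : ℕ) : ℝ))) < 1 := Real.exp_lt_one_iff.2 (by norm_num)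
  refine ⟨pow_nonneg (div_nonneg zero_le_two (by linarith)) _, mul_nonneg (pow_nonneg ?_ _) (pow_nonneg ?_ _)⟩
  · exact div_nonneg (by norm_num) (mul_nonneg (Real.exp_pos _).le (by norm_num))
  · exact div_nonneg zero_le_two (by linarith)

/-- THE TOY KERNEL DATUM (labelled toy): index frame of `wRem γ` (one box, one domain, one cube, the two sources of the current
step, `d_k(Y) ≡ 0`, `κ₁ = 1`, `r_k = 1/8`, `R ≡ 1`); points `ptsBox`, base point `0`, `dX X p := infDist p {0}`, `ρd := dist`,
`m := 1`; summand `F(0)·clamp_γ(s_k)·|p − q|·e^{−(dX p + dX q)}`. [folklore] -/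
def wKer (γ : ℝ) : KerData toyCarriers ℂ Unit Unit Unit Unit Unit (Fin 4 → ℤ) where
  S0 := fun _ _ => {()}
  SY := fun _ _ _ => {()}
  src := fun k _ _ j => if j = k then srcPair k else ∅
  Sq := fun k _ _ j => if j = k then {()} else ∅
  SX := fun k _ _ j _ => if j = k then srcPair k else ∅
  dY := fun _ _ => 0
  κ₁ := 1
  r := fun _ => 1 / 8
  cubes := fun _ _ _ _ => [()]
  R := fun _ => 1
  pts := fun _ _ _ => ptsBox
  p0 := fun _ => 0
  dX := fun _ p => infDist p ({0} : Set (Fin 4 → ℤ))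
  ρd := fun p q => dist p q
  m := 1
  ker := fun k s _ _ _ _ _ _ _ p q F =>
    F 0 * ((gClamp γ (s k) * (dist p q * Real.exp (-(infDist p ({0} : Set (Fin 4 → ℤ)) +
      infDist q ({0} : Set (Fin 4 → ℤ))))) : ℝ) : ℂ)

/-- The toy kernel datum and the toy ray datum `wRem γ` have the SAME index frame (definitionally; the `piece` fields, which
differ, are not part of the frame — unfolded first so that the kernel never compares them). [folklore] -/
theorem frame_wKer (γ : ℝ) : (wKer γ).toC.frame = (wRem γ).toC.frame := by
  unfold CPieceData.frame KerData.toC RemData.toC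
  rfl

/-- `κ₁` of the two toy data agree (both `1`). [folklore] -/
theorem kappa1_wKer (γ : ℝ) : (wKer γ).κ₁ = (wRem γ).κ₁ := rfl

/-- The bilocal weight of the summand is nonnegative. [folklore] -/
theorem weight_nonneg (p q : Fin 4 → ℤ) :
    0 ≤ dist p q * Real.exp (-(infDist p ({0} : Set (Fin 4 → ℤ)) + infDist q ({0} : Set (Fin 4 → ℤ)))) :=
  mul_nonneg dist_nonneg (Real.exp_pos _).le

/-- NON-DEGENERACY (labelled toy): at the unit coupling the summand read on the constant old term `1` IS the bilocal weight
`|p − q|·e^{−(‖p‖+‖q‖)}` — not identically zero, depends on both points; and it depends on the k-th coupling through the clamp.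
[folklore] -/
example (k : ℕ) (y a b : Unit) (x : (doubleCarriers toyCarriers).Dom) (t : ℂ) (s' : Unit → ℝ) (σ' : Unit → ℂ)
    (p q : Fin 4 → ℤ) :
    (wKer 1).ker k (fun _ => 1) y a b x t s' σ' p q (fun _ => 1) =
      ((dist p q * Real.exp (-(infDist p ({0} : Set (Fin 4 → ℤ)) + infDist q ({0} : Set (Fin 4 → ℤ)))) : ℝ) : ℂ) := by
  have h : gClamp 1 1 = 1 := by norm_num [gClamp]
  simp [wKer, h]

/-! ## §2 The binders: `KerData.Admissible` with (G) and (S) BY NAME, (A), (C), (K-Lip), the counts -/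

/-- **`KerData.Admissible` FOR THE TOY** — every field, with `gain ≡ 1⁵`, `cK = 1`, `δ₀ = 1`, `δ₁ = ½`, `w = w₀ = 0`, `d₀ = 0`,
and the (S)-constants of `NE9LatticeExpSums` at d = 4, δ = ½, m = 1 (for `0 ≤ γ ≤ 1`).  (K): `‖F(0)‖ ≤ M` (0 is in the ball),
`|clamp_γ| ≤ γ ≤ 1`.  **(G) := `NE9KernelGeometry.geom_family`** at `S X := {0} ∋ 0`, extent 0.  **(S) :=
`NE9LatticeExpSums.sum_exp_neg_dist_le` / `sum_pow_mul_exp_neg_dist_le`** (any finite point set of ℤ⁴). [folklore] -/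
theorem admissible_wKer {γ : ℝ} (hγ0 : 0 ≤ γ) (hγ1 : γ ≤ 1) :
    (wKer γ).Admissible (fun _ _ => 1) (fun _ _ => (1 : ℝ) ^ 5) 1 1 (1 / 2) 0 0
      ((2 / (1 - Real.exp (-((1 / 2 : ℝ) / ((4 : ℕ) : ℝ))))) ^ (4 : ℕ))
      ((2 * ((1 : ℕ) : ℝ) / (Real.exp 1 * (1 / 2 : ℝ))) ^ (1 : ℕ) *
        (2 / (1 - Real.exp (-((1 / 2 : ℝ) / 2 / ((4 : ℕ) : ℝ))))) ^ (4 : ℕ)) 0 where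
  κ₁_ge := le_rfl
  r_pos := fun _ => by show (0:ℝ) < 1 / 8; norm_num
  R_pos := fun _ => by show (0:ℝ) < 1; norm_num
  kerZero := by
    intro k s y a b x t s' σ' p q
    show (0 : ℂ → ℂ) 0 * _ = 0
    rw [Pi.zero_apply, zero_mul]
  kerBound := by
    intro k s y a _ b _ j x _ t _ s' σ' _ p _ q _ F M _ hM
    have hF0 : ‖F 0‖ ≤ M := hM 0 (by show (0 : ℂ) ∈ ball (0:ℂ) 1; simp)
    have hM0 : 0 ≤ M := (norm_nonneg _).trans hF0
    have hg : |gClamp γ (s k)| ≤ 1 := (abs_gClamp_le hγ0 _).trans hγ1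
    have hW := weight_nonneg p q
    show ‖F 0 * ((gClamp γ (s k) * (dist p q * Real.exp (-(infDist p ({0} : Set (Fin 4 → ℤ)) +
      infDist q ({0} : Set (Fin 4 → ℤ))))) : ℝ) : ℂ)‖ ≤ 1 * M * (1 : ℝ) ^ 5 * dist p q ^ 1 *
        Real.exp (-(1 * (infDist p ({0} : Set (Fin 4 → ℤ)) + infDist q ({0} : Set (Fin 4 → ℤ)))))
    rw [norm_mul, Complex.norm_real, Real.norm_eq_abs, abs_mul, abs_of_nonneg hW, one_mul, one_pow, mul_one, pow_one, one_mul]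
    calc ‖F 0‖ * (|gClamp γ (s k)| * (dist p q * Real.exp (-(infDist p ({0} : Set (Fin 4 → ℤ)) +
          infDist q ({0} : Set (Fin 4 → ℤ))))))
        ≤ M * (1 * (dist p q * Real.exp (-(infDist p ({0} : Set (Fin 4 → ℤ)) + infDist q ({0} : Set (Fin 4 → ℤ)))))) :=
          mul_le_mul hF0 (mul_le_mul_of_nonneg_right hg hW) (mul_nonneg (abs_nonneg _) hW) hM0
      _ = M * dist p q * Real.exp (-(infDist p ({0} : Set (Fin 4 → ℤ)) + infDist q ({0} : Set (Fin 4 → ℤ)))) := by ring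
  geom := geom_family (τ := Bool) (wKer γ).pts (fun _ => ({0} : Set (Fin 4 → ℤ))) (fun _ => (0 : Fin 4 → ℤ)) toyCarriers.d
    (fun _ => (0 : ℝ)) (fun _ => Set.mem_singleton _)
    (fun _ u hu v hv => by rw [Set.mem_singleton_iff.1 hu, Set.mem_singleton_iff.1 hv, dist_self])
    (by norm_num) (by norm_num) (fun _ => by norm_num)
  sum0 := fun _ _ _ _ => sum_exp_neg_dist_le (d := 4) (by norm_num) (by norm_num : (0:ℝ) < 1 / 2) ptsBox 0
  sum1 := fun _ _ _ p _ => sum_pow_mul_exp_neg_dist_le (d := 4) (by norm_num) (by norm_num : (0:ℝ) < 1 / 2) 1 ptsBox p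
  srcScale := by
    intro k y a j x hx
    change x ∈ (if j = k then srcPair k else ∅) at hx
    split_ifs at hx with h
    · change x.1 = j
      rw [fst_eq_of_mem_srcPair hx, h]
    · simp at hx
  G1 := fun _ _ _ _ _ _ => by show (0:ℝ) ≤ 0 + 4 * (([()] : List Unit).length : ℝ); simp
  d0_nonneg := le_rfl
  cK_nonneg := zero_le_one
  gain_nonneg := fun _ _ => by norm_num
  ρd_nonneg := fun _ _ => dist_nonneg
  c0_nonneg := c0_c1_nonneg.1
  c1_nonneg := c0_c1_nonneg.2

/-- **(A) FOR THE TOY**: the summand is subtractive in the old term (it reads `F(0)` linearly) — (w23)'s `hkerA` shape, for all `F₁,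
F₂` (analyticity not even needed). [folklore] -/
theorem kerA_wKer (γ : ℝ) :
    ∀ (k : ℕ) (s : ℕ → ℝ) (y a b : Unit) (x : (doubleCarriers toyCarriers).Dom) (t : ℂ) (s' : Unit → ℝ) (σ' : Unit → ℂ),
      ∀ p ∈ (wKer γ).pts k y a, ∀ q ∈ (wKer γ).pts k y a, ∀ F₁ F₂ : ℂ → ℂ,
        DifferentiableOn ℂ F₁ (ball 0 ((wKer γ).R x.1)) → DifferentiableOn ℂ F₂ (ball 0 ((wKer γ).R x.1)) →
          (wKer γ).ker k s y a b x t s' σ' p q (F₁ - F₂) =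
            (wKer γ).ker k s y a b x t s' σ' p q F₁ - (wKer γ).ker k s y a b x t s' σ' p q F₂ := by
  intro k s y a b x t s' σ' p _ q _ F₁ F₂ _ _
  show (F₁ - F₂) 0 * _ = F₁ 0 * _ - F₂ 0 * _
  rw [Pi.sub_apply, sub_mul]

/-- **(C) FOR THE TOY**: the summand is jointly continuous in the contour point (it does not read it) — (w23)'s / A3-KER's `hkerC`
shape. [folklore] -/
theorem kerC_wKer (γ : ℝ) :
    ∀ (k : ℕ) (s : ℕ → ℝ) (y a b : Unit) (x : (doubleCarriers toyCarriers).Dom), ∀ p ∈ (wKer γ).pts k y a,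
      ∀ q ∈ (wKer γ).pts k y a, ∀ F : ℂ → ℂ, DifferentiableOn ℂ F (ball 0 ((wKer γ).R x.1)) →
        Continuous fun wv : ℂ × (Unit → ℝ) × (Unit → ℂ) => (wKer γ).ker k s y a b x wv.1 wv.2.1 wv.2.2 p q F :=
  fun _ _ _ _ _ _ _ _ _ _ _ _ => continuous_const

/-- **(K-Lip) FOR THE TOY** with `cK = λ = 1`: the coupling difference of the summand is the clamp difference times the bilocal
weight, and the clamp is 1-Lipschitz — A3-KER's `hkerL` shape (for all histories, any window). [folklore] -/
theorem kerL_wKer (γ : ℝ) (W : Set (ℕ → ℝ)) :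
    ∀ g ∈ W, ∀ g' ∈ W, ∀ (k : ℕ) (y : Unit), ∀ a ∈ (wKer γ).S0 k y, ∀ b ∈ (wKer γ).SY k y a, ∀ (j : ℕ),
      ∀ x ∈ (wKer γ).src k y a j, ∀ t ∈ sphere (0:ℂ) ((wKer γ).r k), ∀ (s' : Unit → ℝ) (σ' : Unit → ℂ),
        OnContour (wKer γ).κ₁ ((wKer γ).cubes k y a b) s' σ' → ∀ p ∈ (wKer γ).pts k y a, ∀ q ∈ (wKer γ).pts k y a,
          ∀ (F : ℂ → ℂ) (M : ℝ), DifferentiableOn ℂ F (ball 0 ((wKer γ).R x.1)) →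
            (∀ z ∈ ball (0:ℂ) ((wKer γ).R x.1), ‖F z‖ ≤ M) →
              ‖(wKer γ).ker k g y a b x t s' σ' p q F - (wKer γ).ker k g' y a b x t s' σ' p q F‖ ≤
                1 * 1 * M * (1 : ℝ) ^ 5 * (wKer γ).ρd p q ^ (wKer γ).m *
                  Real.exp (-(1 * ((wKer γ).dX x.1 p + (wKer γ).dX x.1 q))) * |g k - g' k| := by
  intro g _ g' _ k y a _ b _ j x _ t _ s' σ' _ p _ q _ F M _ hM
  have hF0 : ‖F 0‖ ≤ M := hM 0 (by show (0 : ℂ) ∈ ball (0:ℂ) 1; simp)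
  have hM0 : 0 ≤ M := (norm_nonneg _).trans hF0
  have hW := weight_nonneg p q
  have hcl := abs_gClamp_sub_le γ (g k) (g' k)
  set D : ℝ := dist p q * Real.exp (-(infDist p ({0} : Set (Fin 4 → ℤ)) + infDist q ({0} : Set (Fin 4 → ℤ)))) with hD
  show ‖F 0 * ((gClamp γ (g k) * D : ℝ) : ℂ) - F 0 * ((gClamp γ (g' k) * D : ℝ) : ℂ)‖ ≤
      1 * 1 * M * (1 : ℝ) ^ 5 * dist p q ^ 1 *
        Real.exp (-(1 * (infDist p ({0} : Set (Fin 4 → ℤ)) + infDist q ({0} : Set (Fin 4 → ℤ))))) * |g k - g' k|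
  have hfac : F 0 * ((gClamp γ (g k) * D : ℝ) : ℂ) - F 0 * ((gClamp γ (g' k) * D : ℝ) : ℂ) =
      F 0 * (((gClamp γ (g k) - gClamp γ (g' k)) * D : ℝ) : ℂ) := by
    push_cast; ring
  rw [hfac, norm_mul, Complex.norm_real, Real.norm_eq_abs, abs_mul, abs_of_nonneg hW, one_mul, one_mul, one_pow, mul_one,
    pow_one, one_mul]
  calc ‖F 0‖ * (|gClamp γ (g k) - gClamp γ (g' k)| * D) ≤ M * (|g k - g' k| * D) :=
        mul_le_mul hF0 (mul_le_mul_of_nonneg_right hcl hW) (mul_nonneg (abs_nonneg _) hW) hM0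
    _ = M * dist p q * Real.exp (-(infDist p ({0} : Set (Fin 4 → ℤ)) + infDist q ({0} : Set (Fin 4 → ℤ)))) *
          |g k - g' k| := by rw [hD]; ring

/-- **THE LEVEL COUNTS FOR THE TOY** at any rate (`O1 = 2`, `c_Q = 1`, gain `1⁵`, profile `agePow ω`): `NE9RemainderSpeciesWitness
.levelCountsG_wRem` transported along `frame_wKer`. [folklore] -/
theorem levelCountsG_wKer (γ κ : ℝ) {ω : ℝ} (hω : 0 ≤ ω) :
    LevelCountsG (wKer γ).toC.frame κ (wKer γ).κ₁ 2 1 (fun _ _ => (1 : ℝ) ^ 5) (agePow ω) := by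
  rw [frame_wKer, kappa1_wKer]
  exact levelCountsG_wRem γ κ hω

/-! ## §3 The producers FIRE on the toy -/

/-- **(w23) FIRES**: the four S-binders of the NE9 END (S3 `ChannelAdditive`, S4 `ChannelLocal` / `ChannelStepSum`, S5
`ChannelSizeAtStepNN` at the two-rate weight, here with `w = 0`) for the toy's channel `cpieceChannel (wKer γ).toC` on its analytic
class — `NE9Lemma1KernelSpeciesAdditive.sBinders_ker` APPLIED to `admissible_wKer`, the counts, (A), (C). [folklore] -/
theorem sBinders_witness_ker {γ : ℝ} (hγ0 : 0 ≤ γ) (hγ1 : γ ≤ 1) (κ : ℝ) {ω : ℝ} (hω : 0 ≤ ω) :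
    ChannelAdditive (analyticClass (wKer γ).R) (cpieceChannel (wKer γ).toC) ∧
      ChannelLocal (analyticClass (wKer γ).R) (cpieceChannel (wKer γ).toC) ∧
      ChannelStepSum (analyticClass (wKer γ).R) (cpieceChannel (wKer γ).toC) ∧
      ChannelSizeAtStepNN (analyticClass (wKer γ).R) (cpieceChannel (wKer γ).toC) κ
        (weightOf (wKer γ).toC.frame (wKer γ).κ₁ 0 2 ((wKer γ).Kp 1 0
          ((2 / (1 - Real.exp (-((1 / 2 : ℝ) / ((4 : ℕ) : ℝ))))) ^ (4 : ℕ))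
          ((2 * ((1 : ℕ) : ℝ) / (Real.exp 1 * (1 / 2 : ℝ))) ^ (1 : ℕ) *
            (2 / (1 - Real.exp (-((1 / 2 : ℝ) / 2 / ((4 : ℕ) : ℝ))))) ^ (4 : ℕ))))
        (tauOfG 1 (agePow ω)) :=
  sBinders_ker (admissible_wKer hγ0 hγ1) κ (levelCountsG_wKer γ (κ - 0) hω) zero_le_two
    (fun k j => by rw [one_mul]; exact agePow_nonneg hω k j) (kerA_wKer γ) (kerC_wKer γ)

/-- **A3-KER FIRES**: leaf A3's `hTcup` for the toy's channel at the toy window family `wE γ` (analytic, (1.18)-size `γ`) —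
`NE9KernelSpeciesCoupling.channelCouplingModulus_ker` APPLIED to `admissible_wKer`, (C), (K-Lip) (λ = 1), the counts; the END's
constant comes out as `qT = 1·γ·1·(1 − ω)⁻¹` at the S5 weight. [folklore] -/
theorem tcup_witness_ker {γ : ℝ} (hγ0 : 0 ≤ γ) (hγ1 : γ ≤ 1) (W : Set (ℕ → ℝ)) (κ : ℝ) {ω : ℝ} (hω0 : 0 ≤ ω)
    (hω1 : ω < 1) :
    ∀ g ∈ W, ∀ g' ∈ W, ∀ (k : ℕ) (y : Unit),
      |cpieceChannel (wKer γ).toC k g (wE γ g) y - cpieceChannel (wKer γ).toC k g' (wE γ g) y| ≤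
        weightOf (wKer γ).toC.frame (wKer γ).κ₁ 0 2 ((wKer γ).Kp 1 0
          ((2 / (1 - Real.exp (-((1 / 2 : ℝ) / ((4 : ℕ) : ℝ))))) ^ (4 : ℕ))
          ((2 * ((1 : ℕ) : ℝ) / (Real.exp 1 * (1 / 2 : ℝ))) ^ (1 : ℕ) *
            (2 / (1 - Real.exp (-((1 / 2 : ℝ) / 2 / ((4 : ℕ) : ℝ))))) ^ (4 : ℕ))) k y *
          (1 * γ * 1 * (1 - ω)⁻¹ * |g k - g' k|) :=
  channelCouplingModulus_ker (admissible_wKer hγ0 hγ1) (Ef := wE γ) (N := fun _ => γ) (fun g _ => wE_mem_analyticClass γ g)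
    (termSize_wE hγ0 W κ) (fun _ => hγ0) (fun _ => le_rfl) zero_le_one (kerC_wKer γ) (kerL_wKer γ W)
    (levelCountsG_wKer γ (κ - 0) hω0) zero_le_two zero_le_one hω0 hω1

end Summit.QuantumFields.BalabanUV.T4Continuum.NE9KernelSpeciesWitness

end
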